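import Summits.QuantumFields.YangMills.Theorems.BalabanLadderIRPinnedExitCofinal
import Summits.QuantumFields.YangMills.Theorems.BalabanLadderIRRankPurityCofinal
import Summits.QuantumFields.YangMills.Theorems.BalabanLadderIRTwistCostOfPurity
import Summits.QuantumFields.YangMills.Theorems.BalabanLadderIRColdPurityDobrushinCorner
import Summits.QuantumFields.YangMills.Theses.BalabanLadder
import HarnessLib

/-!
# Crux `IRcof` (stmt-QuantumFields-26930) — LINE `deconfinement-ruler` (ideator ym-ir-idea-21 g0, lens `barrier` = barrier-inversion)
# `PXcof(1∕24) ⇐ (CU) PinnedConfinedCofinal(1∕12) ∧ (G) ConfinedToPure(1∕12, 1∕24) ∧ (CF) PXcof on the centre-free class`, then the slot's bill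

TOKEN ASSEMBLY (D-0146) onto the slot of record rev 2 `Cruxes/IRcof/Lines/pinned_cofinal_bill.lean` (ce8a790cd962) {PXcof(1∕24), N_cof}:
this file PRODUCES the token `PinnedExitsCofinalAt (1/24)` (verbatim copy of the slot's def, §0) from three stubs and then concludes
`Summit.QuantumFields.YangMills.Theses.BalabanLadder.IRcof` LITERALLY with the fourth stub N_cof = `RankPurity.IRnscCof` BY NAME.

THE LEVER (barrier-inversion).  Both refuting witnesses in play — the finite-temperature deconfinement barrier
(`Literature.Barriers.QuantumFields.FiniteTemperatureDeconfinement`, BS83: a thick box with temporal extent `t < N_{τ,c}(β)` has LIGHT electric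
flux) and the tree negative `not_uniformExit24_holds` ∕ `pure_box_is_long_holds` (p621160: a `1∕24`-pure even `4:1` box at `SU(2)` has
`L > β∕204`, via the heavy-twist window `twistRatio_SU2_le`) — are ONE mechanism: light 't Hooft flux.  The statement JUST OUTSIDE their common
class indexes the box not by `β`, not by the unit map, but by the DECONFINEMENT RULER ITSELF: «the thick `4:1` box is margin-confined»
(`MarginConfinedAt`: every central temporal twist costs at most the fraction `η` of `Z(L³×⌊L∕4⌋)`).  The schedule is
`(t, L, aspect) = (⌊L∕4⌋, κ·L_conf(β), 4:1)` with `L_conf(β)` any margin-confined scale — the decl's geometry is UNCHANGED (census §K(21):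
a changed geometry would be a new statement), so the line concludes PXcof literally.

THE CUT.  PXcof(θ) ⇐ (CU)(η) ∧ (G)(η, θ) ∧ (CF)(θ)  [`pxcof_of_ruler`, PROVED], with
* (CU) `PinnedConfinedCofinal η` — under IRcof's own floor `LowerBounds G r a`: `∃ T ∀ β₁ ∃ β ≥ β₁ ∃ L ≥ 8, a(β)·L ≤ T ∧` the box `L³×⌊L∕4⌋`
  is `η`-margin-confined.  NECESSARY: `PXcof(θ) ⇒ (CU)(2θ)` [`pinnedConfinedCofinal_of_pxcof`, PROVED, by S1 = `TwistCost.half_twist_cost_le_coldDefect`].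
  Strictly SMALLER than PXcof: confinement of ONE pinned thick box per cofinal coupling + the AF half of the floor handshake; NO glueball gap.
* (G) `ConfinedToPure η θ` — floor-free, unit-free, `a`-free, SAME β on both sides (not RG-diagonal): for simply-connected simple `G` with
  NON-TRIVIAL centre and every `r` there are `κ ≥ 1` and `β₀` with: `∀ β ≥ β₀ ∀ L ≥ 8`, margin-confined at `(β, L)` ⇒ `coldDefect r.ρ β (κL) ≤ θ`.
  This is where «uniformity survives the deconfinement edge» (census §K(21)) is ANSWERED: in the `4:1` geometry the temperature of the box `κL`
  is `T_c∕(κ·x)` with `x = t∕N_{τ,c} ≳ 1.2` forced by the margin, so the purity defect of the `κL` box is a CONTINUUM number — glueball gas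
  `≈ 8 x_κ^{3∕2} e^{−x_κ}`, `x_κ = κ·x·m_{0⁺⁺}∕T_c` (`m∕T_c ≈ 5.3` SU(2), `≈ 5.7–6.5` SU(3)): `κ = 1 → ≈ 0.2 > 1∕24` (E4-G2: `δᶜ ≈ ½` AT the edge),
  `κ = 2 → ≈ 10⁻³ < 1∕24`.  `κ` is `∃`-bound (checklist 4c(iv)); `κ = 2` is the E2-Q3 calibration target, GUIDANCE only.
* (CF) `PinnedExitsCofinalCentreFreeAt θ` — PXcof VERBATIM on the centre-free simply-connected simple groups (`G₂, F₄, E₈`: no 't Hooft flux, no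
  ruler); NECESSARY (restriction); SAME WALL as row 37 there — the line offers nothing on that class and says so.
Where `G`'s structure enters: (CU) is FALSE for `U(1)₄` read as a centre-twist statement (Coulomb flux is light: GoepfertMack1982 ∕ Guth1980) and
vacuous-antecedent here anyway (`U(1)` is not simple); (G) is NOT group-blind in mechanism (it is the gap of the flux-free sector in `T_c` units) but its
hypothesis is never met where flux is light, so abelian ∕ finite ∕ `SO(3)` instances do not test it — the LOAD of the group sieve sits in (CU).

BARRIER PLACEMENT (per catalogued barrier; details on the card `Lines/deconfinement-ruler.md`):
* FiniteTemperatureDeconfinement (BS83): OUTSIDE — evasion (a) «use the temporal extent»: every box the line reads has `t` above the ruler by HYPOTHESIS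
  (margin), never `t` blind; (CU) asks confinement only cofinally and only of thick boxes.
* `not_uniformExit24_holds` ∕ `pure_box_is_long_holds` ∕ `not_pinnedExitsCofinalFree` (p621160, p624174): OUTSIDE — (CU) chooses the box AFTER the coupling
  and KEEPS `LowerBounds` (deleting it makes (CU) false at `slowUnit` by the same window: a margin-confined even box has `L > β∕51`); (G) fixes `L`
  before `β` only under the margin hypothesis, which the window REFUTES at `β ≥ 204⌊L∕4⌋` (even `L`), so (G) holds there vacuously — consistent.
* AbelianDeconfinementD4 ∕ MigdalKadanoffGroupBlindness: the carrier (CU) is centre-flux confinement, false for `U(1)₄`; no decimation monotonicity is used.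
* DiscreteSubgroupFreezing ∕ EguchiKawaiBreakdown ∕ DiluteInstantonGasDivergence: not in the technique class (no finite-subgroup approximation, no
  volume reduction, no semiclassical gas); recorded on the card.

RUNG (PROVED, format-grade, group-blind): `confinedToPure_rung_dobrushin` — at the Dobrushin door `0 ≤ β ≤ 1∕(216N)` the conclusion of (G) holds
with ONE group-free `κ` for every `L ≥ 8` (hypothesis unused), from `ColdPurityDobrushin.coldExitAt_corner_of_dobrushinTV`.

HONEST LABEL: the Yang–Mills mass gap (Clay) is NOT proved; `IRcof` 0∕1, `IR` 0∕1; R2c IDEA-BOUND; R4 = `BalabanLadder.UV` only; every Monte-Carlo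
number quoted here or on the card is GUIDANCE.  The four stubs carry ALL the content; the compositions are bookkeeping.
-/

set_option autoImplicit false

noncomputable section

open Filter Topology MeasureTheory
open Literature.MathematicalPhysics.QuantumFieldTheory Literature.MathematicalPhysics.QuantumLattice
open Summit.QuantumFields.YangMills.Cruxes.OSLegsFromFemtoAndGap.DlrCollarTransfer (LowerBounds)
open Summit.QuantumFields.YangMills.Cruxes.IR.ColdPurityBridge (coldDefect)
open Summit.QuantumFields.YangMills.Cruxes.IR.RankPurity (IRnscCof IRcof_of_split)
open Summit.QuantumFields.YangMills.Cruxes.IR.PinnedExitCofinal (ircofSC_of_pinnedExitsCofinal_le)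
open Summit.QuantumFields.YangMills.Cruxes.IR.TwistCost (half_twist_cost_le_coldDefect)
open Summit.QuantumFields.YangMills.Cruxes.IR.ColdPurityDobrushin (coldExitAt_corner_of_dobrushinTV)

namespace Summit.QuantumFields.YangMills.Cruxes.IRcof.DeconfinementRuler

/-! ## §0 The slot token, verbatim (`PinnedCofinalBill.PinnedExitsCofinalAt`, ce8a790cd962) -/

/-- **PXcof(θ)** — verbatim copy of the slot's `PinnedCofinalBill.PinnedExitsCofinalAt θ` (the `Lines/` workfile is not imported; the body is
the hypothesis of the landed kernel `PinnedExitCofinal.ircofSC_of_pinnedExitsCofinal_le`). -/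
def PinnedExitsCofinalAt (θ : ℝ) : Prop :=
  ∀ (G : Type) [Group G] [TopologicalSpace G] [IsTopologicalGroup G] [CompactSpace G],
    IsCompactSimpleLieGroup G → SimplyConnectedSpace G →
    letI : MeasurableSpace G := borel G
    haveI : BorelSpace G := ⟨rfl⟩
    ∀ (r : LatticeRep G) (a : ℝ → ℝ), (∀ β, 0 < a β) → Tendsto a atTop (𝓝 0) → LowerBounds G r a →
      ∃ T : ℝ, ∀ β₁ : ℝ, ∃ β : ℝ, β₁ ≤ β ∧ ∃ L : ℕ, 8 ≤ L ∧ a β * (L : ℝ) ≤ T ∧ coldDefect r.ρ β L ≤ θ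

/-! ## §1 The deconfinement ruler: margin-confined thick boxes -/

section Ruler

variable {G : Type} [Group G] [TopologicalSpace G] [IsTopologicalGroup G] [CompactSpace G]
  [MeasurableSpace G] [BorelSpace G] {N : ℕ}

/-- **`η`-MARGIN-CONFINED thick box** `L³ × ⌊L∕4⌋` at coupling `β`: every central temporal twist `z` ('t Hooft electric flux, all three
directions, `wilsonFinTorusTwistedPartition`) lowers Wilson's partition function by at most the fraction `η`:
`1 − Z^{(z)}(L,L,L,⌊L∕4⌋) ∕ Z(L,L,L,⌊L∕4⌋) ≤ η`.  The finite-box, instrumentable form of «the box sits above the deconfinement ruler,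
`t > N_{τ,c}(β)`, with margin» (E2-Q3's twist-weight rows).  Always `≥ 0` (`TwistCost.twistedPartition_le`). -/
def MarginConfinedAt (ρ : G →* Matrix (Fin N) (Fin N) ℂ) (β : ℝ) (L : ℕ) (η : ℝ) : Prop :=
  ∀ z : Fin 4 → G, (∀ μ, z μ ∈ Subgroup.center G) →
    1 - wilsonFinTorusTwistedPartition ρ β z L L L (L / 4) / wilsonFinTorusPartition ρ β L L L (L / 4) ≤ η

end Ruler

/-! ## §2 The three statements of the cut -/

/-- **(CU) `PinnedConfinedCofinal η` — ONE PINNED MARGIN-CONFINED THICK BOX AT COFINALLY MANY COUPLINGS (under the crux's own floor).**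
For simply-connected compact simple `G`, every `r`, every positive unit map `a → 0` with `LowerBounds G r a`: `∃ T ∀ β₁ ∃ β ≥ β₁ ∃ L ≥ 8`,
`a(β)·L ≤ T` and `L³×⌊L∕4⌋` is `η`-margin-confined.  NECESSARY for PXcof(`η∕2`) (`pinnedConfinedCofinal_of_pxcof`); carries confinement of one
thick box + the AF half of the floor handshake, NOT the gap.  Why it might fail: deconfinement at `T = 0` for some simple `G`; or the floor
`LowerBounds` holding at units too coarse for any confined box to be pinned (`a(β)·L_conf(β) → ∞`).  Without the floor it is FALSE
(`slowUnit`, heavy-twist window — p624174's mechanism). -/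
def PinnedConfinedCofinal (η : ℝ) : Prop :=
  ∀ (G : Type) [Group G] [TopologicalSpace G] [IsTopologicalGroup G] [CompactSpace G],
    IsCompactSimpleLieGroup G → SimplyConnectedSpace G →
    letI : MeasurableSpace G := borel G
    haveI : BorelSpace G := ⟨rfl⟩
    ∀ (r : LatticeRep G) (a : ℝ → ℝ), (∀ β, 0 < a β) → Tendsto a atTop (𝓝 0) → LowerBounds G r a →
      ∃ T : ℝ, ∀ β₁ : ℝ, ∃ β : ℝ, β₁ ≤ β ∧ ∃ L : ℕ, 8 ≤ L ∧ a β * (L : ℝ) ≤ T ∧ MarginConfinedAt r.ρ β L η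

/-- **(G) `ConfinedToPure η θ` — MARGIN-CONFINED AT SCALE `L` ⇒ `θ`-PURE AT SCALE `κL`, UNIFORMLY IN THE COUPLING (floor-free, unit-free).**
For simply-connected compact simple `G` WITH NON-TRIVIAL CENTRE and every `r`: `∃ κ ≥ 1 ∃ β₀ ∀ β ≥ β₀ ∀ L ≥ 8`,
`MarginConfinedAt r.ρ β L η → coldDefect r.ρ β (κL) ≤ θ`.  The gap in deconfinement units: in the `4:1` geometry the `κL` box sits at
`T ≈ T_c∕(1.2κ)`, and its defect is the scale-free glueball-gas number `≈ 8x^{3∕2}e^{−x}`, `x = 1.2κ·m∕T_c` (GUIDANCE `κ = 2` suffices at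
`SU(2)`, `SU(3)`).  Why it might fail: `m_{0⁺⁺}∕T_c` not bounded below along `β → ∞` for some `(G, r)` (no `β`-uniform `κ`); lattice artefacts at
`t = N_{τ,c} ∈ {2,3}` if `β₀` is taken too small (harmless: `β₀` is `∃`-bound).  Skew to PXcof (neither implies the other); vacuous wherever flux
is light (femto boxes, deconfined boxes), refuted-hypothesis-true in the heavy-twist window. -/
def ConfinedToPure (η θ : ℝ) : Prop :=
  ∀ (G : Type) [Group G] [TopologicalSpace G] [IsTopologicalGroup G] [CompactSpace G],
    IsCompactSimpleLieGroup G → SimplyConnectedSpace G → (∃ z : G, z ∈ Subgroup.center G ∧ z ≠ 1) →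
    letI : MeasurableSpace G := borel G
    haveI : BorelSpace G := ⟨rfl⟩
    ∀ r : LatticeRep G, ∃ κ : ℕ, ∃ β₀ : ℝ, 1 ≤ κ ∧ ∀ β : ℝ, β₀ ≤ β → ∀ L : ℕ, 8 ≤ L →
      MarginConfinedAt r.ρ β L η → coldDefect r.ρ β (κ * L) ≤ θ

/-- **(CF) `PinnedExitsCofinalCentreFreeAt θ` — PXcof VERBATIM on the CENTRE-FREE simply-connected simple groups (`G₂, F₄, E₈`).**
NECESSARY (restriction of PXcof); the deconfinement ruler has no purchase there (no 't Hooft flux); SAME WALL as row 37 on that class. -/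
def PinnedExitsCofinalCentreFreeAt (θ : ℝ) : Prop :=
  ∀ (G : Type) [Group G] [TopologicalSpace G] [IsTopologicalGroup G] [CompactSpace G],
    IsCompactSimpleLieGroup G → SimplyConnectedSpace G → (∀ z : G, z ∈ Subgroup.center G → z = 1) →
    letI : MeasurableSpace G := borel G
    haveI : BorelSpace G := ⟨rfl⟩
    ∀ (r : LatticeRep G) (a : ℝ → ℝ), (∀ β, 0 < a β) → Tendsto a atTop (𝓝 0) → LowerBounds G r a →
      ∃ T : ℝ, ∀ β₁ : ℝ, ∃ β : ℝ, β₁ ≤ β ∧ ∃ L : ℕ, 8 ≤ L ∧ a β * (L : ℝ) ≤ T ∧ coldDefect r.ρ β L ≤ θ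

/-! ## §3 Stubs (sorries ONLY here) -/

/-- **stub (CU)** — one pinned `1∕12`-margin-confined thick box at cofinally many couplings, under the floor. -/
theorem stub_pinnedConfinedCofinal : PinnedConfinedCofinal (1 / 12) := by
  sorry

/-- **stub (G)** — `1∕12`-margin-confined at `L` ⇒ `1∕24`-pure at `κL`, `κ` uniform in `β` (the located residual: the gap in `T_c` units). -/
theorem stub_confinedToPure : ConfinedToPure (1 / 12) (1 / 24) := by
  sorry

/-- **stub (CF)** — PXcof(1∕24) verbatim on the centre-free class (`G₂, F₄, E₈`); no lever offered. -/
theorem stub_pxcofCentreFree : PinnedExitsCofinalCentreFreeAt (1 / 24) := by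
  sorry

/-- **stub N_cof** — the slot's second token BY NAME (`RankPurity.IRnscCof`). -/
theorem stub_irnscCof : IRnscCof := by
  sorry

/-! ## §4 PROVED: the cut is sound (`(CU) ∧ (G) ∧ (CF) ⇒ PXcof`) and (CU), (CF) are necessary -/

/-- **`(CU)(η) ∧ (G)(η,θ) ∧ (CF)(θ) ⇒ PXcof(θ)` (PROVED).**  Centre non-trivial: take (CU)'s cofinal pinned margin-confined box `L` beyond
`max β₁ β₀` and read (G) at `κL` — pinned by `κT`.  Centre-free: (CF) verbatim. -/
theorem pxcof_of_ruler {η θ : ℝ} (hCU : PinnedConfinedCofinal η) (hG : ConfinedToPure η θ)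
    (hCF : PinnedExitsCofinalCentreFreeAt θ) : PinnedExitsCofinalAt θ := by
  intro G _ _ _ _ hGs hsc
  letI : MeasurableSpace G := borel G
  haveI : BorelSpace G := ⟨rfl⟩
  intro r a ha ha0 hlb
  by_cases hZ : ∃ z : G, z ∈ Subgroup.center G ∧ z ≠ 1
  · obtain ⟨T, hcof⟩ := hCU G hGs hsc r a ha ha0 hlb
    obtain ⟨κ, β₀, hκ, hup⟩ := hG G hGs hsc hZ r
    refine ⟨(κ : ℝ) * T, fun β₁ => ?_⟩
    obtain ⟨β, hβ, L, hL, hpin, hconf⟩ := hcof (max β₁ β₀)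
    refine ⟨β, (le_max_left _ _).trans hβ, κ * L, ?_, ?_, hup β ((le_max_right _ _).trans hβ) L hL hconf⟩
    · calc 8 ≤ L := hL
        _ = 1 * L := (one_mul L).symm
        _ ≤ κ * L := Nat.mul_le_mul_right L hκ
    · have hk : (0 : ℝ) ≤ (κ : ℝ) := Nat.cast_nonneg κ
      calc a β * ((κ * L : ℕ) : ℝ) = (κ : ℝ) * (a β * (L : ℝ)) := by push_cast; ring
        _ ≤ (κ : ℝ) * T := mul_le_mul_of_nonneg_left hpin hk
  · push Not at hZ
    exact hCF G hGs hsc hZ r a ha ha0 hlb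

/-- **(CU) IS NECESSARY: `PXcof(θ) ⇒ PinnedConfinedCofinal(2θ)` (PROVED)** — S1 (`TwistCost.half_twist_cost_le_coldDefect`: half the twist cost of
the thick box is below the purity defect) at PXcof's own pinned box, asked beyond `max β₁ 0`. -/
theorem pinnedConfinedCofinal_of_pxcof {θ : ℝ} (hP : PinnedExitsCofinalAt θ) : PinnedConfinedCofinal (2 * θ) := by
  intro G _ _ _ _ hGs hsc
  letI : MeasurableSpace G := borel G
  haveI : BorelSpace G := ⟨rfl⟩
  intro r a ha ha0 hlb
  haveI : SecondCountableTopology G :=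
    (r.continuous.isClosedEmbedding r.injective).isEmbedding.secondCountableTopology
  obtain ⟨T, hcof⟩ := hP G hGs hsc r a ha ha0 hlb
  refine ⟨T, fun β₁ => ?_⟩
  obtain ⟨β, hβ, L, hL, hpin, hδ⟩ := hcof (max β₁ 0)
  refine ⟨β, (le_max_left _ _).trans hβ, L, hL, hpin, fun z hz => ?_⟩
  have h := (half_twist_cost_le_coldDefect r.continuous r.mem_unitary ((le_max_right _ _).trans hβ) hL hz).1
  linarith

/-- **(CF) IS NECESSARY** (restriction). -/
theorem pxcofCentreFree_of_pxcof {θ : ℝ} (hP : PinnedExitsCofinalAt θ) : PinnedExitsCofinalCentreFreeAt θ := by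
  intro G _ _ _ _ hGs hsc _
  exact hP G hGs hsc

/-- **`1∕12 = 2·(1∕24)`: the registered (CU) is exactly PXcof(1∕24)'s necessary conjunct.** -/
theorem stubCU_of_pxcof24 (hP : PinnedExitsCofinalAt (1 / 24)) : PinnedConfinedCofinal (1 / 12) := by
  have h := pinnedConfinedCofinal_of_pxcof hP
  norm_num at h
  exact h

/-! ## §5 PROVED RUNG for (G) at the Dobrushin door (format-grade, group-blind, hypothesis unused) -/

/-- **(G) at strong coupling, ONE group-free `κ`:** for every `θ > 0` there is `κ ≥ 1` such that for every compact metrisable `G`, every `r`,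
every `0 ≤ β ≤ 1∕(216N)`, every `L ≥ 8` and every margin `η`, `MarginConfinedAt r.ρ β L η → coldDefect r.ρ β (κL) ≤ θ` — from the landed
cold-purity corner `ColdPurityDobrushin.coldExitAt_corner_of_dobrushinTV` (the hypothesis is not used: inside the door every long box is pure). -/
theorem confinedToPure_rung_dobrushin {θ : ℝ} (hθ : 0 < θ) :
    ∃ κ : ℕ, 1 ≤ κ ∧ ∀ (G : Type) [Group G] [TopologicalSpace G] [IsTopologicalGroup G] [CompactSpace G]
      [MeasurableSpace G] [BorelSpace G] (r : LatticeRep G) (β : ℝ), 0 ≤ β → 216 * (r.N : ℝ) * β ≤ 1 →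
      ∀ L : ℕ, 8 ≤ L → ∀ η : ℝ, MarginConfinedAt r.ρ β L η → coldDefect r.ρ β (κ * L) ≤ θ := by
  obtain ⟨L₀, hL₀⟩ := coldExitAt_corner_of_dobrushinTV hθ
  refine ⟨max L₀ 1, le_max_right _ _, fun G _ _ _ _ _ _ r β h0 hβ L hL η _ => ?_⟩
  refine hL₀ G r β h0 hβ (max L₀ 1 * L) ?_
  calc L₀ ≤ max L₀ 1 := le_max_left _ _
    _ = max L₀ 1 * 1 := (mul_one _).symm
    _ ≤ max L₀ 1 * L := Nat.mul_le_mul_left _ (by omega)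

/-! ## §5b The line's FIRST LEMMA toward (G), typed (a `Prop`, no sorry; located-B): confinement heredity UPWARD in scale -/

/-- **F_κ `ConfinementHeredityUp η ε`** — the cheapest genuinely new lemma of the line (pure confinement finite-size scaling, no gap, no unit
map, same `β`): for simply-connected simple `G` with non-trivial centre and every `r`, `∃ κ ≥ 1 ∃ β₀ ∀ β ≥ β₀ ∀ L ≥ 8`, an `η`-margin-confined
thick box at scale `L` forces an `ε`-margin-confined thick box at scale `κL` (flux free energy grows like `σ(T)(κL)²∕4`; intended tool:
reflection-positivity ∕ chessboard sub-multiplicativity of twisted partition functions in the spatial directions, Tomboulis–Yaffe type).  With the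
flux-averaged purity half V_κ it gives (G) through the PROVED seam `FluxPuritySplit.coldDefect_le_of_flux_vac` (row 21 file; not imported here). -/
def ConfinementHeredityUp (η ε : ℝ) : Prop :=
  ∀ (G : Type) [Group G] [TopologicalSpace G] [IsTopologicalGroup G] [CompactSpace G],
    IsCompactSimpleLieGroup G → SimplyConnectedSpace G → (∃ z : G, z ∈ Subgroup.center G ∧ z ≠ 1) →
    letI : MeasurableSpace G := borel G
    haveI : BorelSpace G := ⟨rfl⟩
    ∀ r : LatticeRep G, ∃ κ : ℕ, ∃ β₀ : ℝ, 1 ≤ κ ∧ ∀ β : ℝ, β₀ ≤ β → ∀ L : ℕ, 8 ≤ L →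
      MarginConfinedAt r.ρ β L η → MarginConfinedAt r.ρ β (κ * L) ε

/-- F_κ is monotone in the target margin (bookkeeping; shows the `Prop` is used). -/
theorem confinementHeredityUp_mono {η ε ε' : ℝ} (hε : ε ≤ ε') (h : ConfinementHeredityUp η ε) :
    ConfinementHeredityUp η ε' := by
  intro G _ _ _ _ hGs hsc hZ
  letI : MeasurableSpace G := borel G
  haveI : BorelSpace G := ⟨rfl⟩
  intro r
  obtain ⟨κ, β₀, hκ, hup⟩ := h G hGs hsc hZ r
  exact ⟨κ, β₀, hκ, fun β hβ L hL hm z hz => (hup β hβ L hL hm z hz).trans hε⟩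

/-! ## §6 Composition onto the slot: the route decl BY NAME -/

/-- The bill as ONE proposition (behind a `def`, so that `IRcof_of_stubs` is the file's only crux-headed theorem). -/
def Bill : Prop :=
  PinnedConfinedCofinal (1 / 12) → ConfinedToPure (1 / 12) (1 / 24) → PinnedExitsCofinalCentreFreeAt (1 / 24) → IRnscCof →
    Summit.QuantumFields.YangMills.Theses.BalabanLadder.IRcof

/-- **The bill holds (PROVED composition, stub-free):** `(CU) → (G) → (CF) → N_cof → IRcof` — the token PXcof(1∕24) by `pxcof_of_ruler`, the
simply-connected half of the leaf by the landed kernel `PinnedExitCofinal.ircofSC_of_pinnedExitsCofinal_le`, the `π₁ ≠ 1` half = N_cof, joined by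
`RankPurity.IRcof_of_split`. -/
theorem IRcof_of : Bill := by
  intro hCU hG hCF hN
  exact IRcof_of_split (ircofSC_of_pinnedExitsCofinal_le (by norm_num) (pxcof_of_ruler hCU hG hCF)) hN

/-- **`IRcof` (the route's decl, literally) from the four registered stubs.** -/
theorem IRcof_of_stubs : Summit.QuantumFields.YangMills.Theses.BalabanLadder.IRcof :=
  IRcof_of stub_pinnedConfinedCofinal stub_confinedToPure stub_pxcofCentreFree stub_irnscCof

/-- The slot token from the stubs (for readers assembling by token: `PinnedCofinalBill.IRcof_of` consumes exactly this and N_cof). -/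
theorem pxcof24_of_stubs : PinnedExitsCofinalAt (1 / 24) :=
  pxcof_of_ruler stub_pinnedConfinedCofinal stub_confinedToPure stub_pxcofCentreFree

end Summit.QuantumFields.YangMills.Cruxes.IRcof.DeconfinementRuler

end
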